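import Summits.AtomisticToContinuum.FouriersLaw.Theorems.OddSectorIrreversibilityOddDensityIsCorrectorRegularity
import Summits.AtomisticToContinuum.FouriersLaw.Theorems.JunctionLocalitySuperadditiveResistancePlainResponseUnique
import Summits.AtomisticToContinuum.FouriersLaw.Theorems.JunctionLocalitySuperadditiveResistanceKuboCutoff

/-!
# `Range(λ - L)|C_c^∞` is dense in `L²(μ_T)` for the equilibrium Langevin generator

Helper (`--supports`) for the line `bath-bond-deficit-integral` of the crux
`BondHeatUncertainty.SubdiffusiveBondHeat` (stmt-AtomisticToContinuum-9120): the registered stub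
`stub_resolventRangeDense` of the lead's skeleton (input of kernel detailed balance via
resolvents).

For the pinned anharmonic chain `pinnedChain ω₂ lam β γ` (`ω₂, lam, β, γ > 0`), `N ≥ 1`, `T > 0`,
the equilibrium generator `L = L_{T,T}` and `λ > 0`: an `L²(μ_T)` function `k` orthogonal to
`(λ - L)(C_c^∞)`, i.e. `∫ (λF - LF) k dμ_T = 0` for all test `F`, vanishes `μ_T`-a.e.
(`stub_resolventRangeDense`). Proof:

1. REGULARITY (`exists_contDiff_ae_eq_of_weak_resolvent`, Hörmander's theorem in the tree):
   `k` is `μ_T`-a.e. a smooth `g`, and `g ∈ L²(μ_T)`.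
2. CLASSICAL EQUATION: moving `L` onto `g` (`integral_generator_mul_eq_adjoint`,
   `L_T^† = -X_H + γ S_B` with `X_H = liouvilleOp`, `S_B = bathOp N bathWeight T`) and the
   fundamental lemma of the calculus of variations give `λ g = -X_H g + γ S_B g` pointwise.
3. ENERGY ESTIMATE (`pinnedChain_resolvent_energy_estimate`, the only new step): testing the
   classical equation against `χ_n g e^{-H/T}` with the energy cutoffs `χ_n` of the Kubo toolkit
   (`integral_chi_liouville_antisymm`: the Liouville part drops out exactly;
   `integral_chi_mul_bathOp`: the bath part is `-T Σ_b B_b (∫ χ_n (∂_b g)² ρ + ∫ g ∂_bχ_n ∂_b g ρ)`;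
   completing the square with `(∂_b χ_n)² ≤ (4K/(n+1)) χ_n`) gives
   `λ ∫ χ_n g² e^{-H/T} ≤ (c T K Σ_b B_b /(n+1)) ∫ g² e^{-H/T} → 0`, while the left side tends to
   `λ ∫ g² e^{-H/T}` (`tendsto_integral_chi_mul`). Hence `g ≡ 0`
   (`pinnedChain_eq_zero_of_classical_adjoint_resolvent`) and `k = 0` `μ_T`-a.e.

References: Eckmann–Pillet–Rey-Bellet 1999 §3 (dissipativity of the equilibrium generator);
folklore (essential m-dissipativity of `(L, C_c^∞)` in `L²(μ_T)`).
-/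

noncomputable section

open MeasureTheory Filter Topology Set
open scoped ENNReal NNReal ContDiff
open Literature.MathematicalPhysics.KineticTheory.HeatConduction
open Summit.AtomisticToContinuum.FouriersLaw.Theorems.SuperadditiveResistance.DeviceLiouville
open Summit.AtomisticToContinuum.FouriersLaw.Theorems.SuperadditiveResistance.Kubo

namespace Summit.AtomisticToContinuum.FouriersLaw.Theorems.SubdiffusiveBondHeat

/-! ### The energy estimate for classical solutions of `λ g = σ X_H g + c S_B g` -/

/-- Completing the square: with `χ ≥ 0`, `κ ≥ 0` and `e² ≤ κ χ`,
`-(χ a a + g e a) ≤ (κ/4) g²`. [folklore] -/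
theorem resolvent_cross_aux {χ κ e a g : ℝ} (hχ : 0 ≤ χ) (hκ : 0 ≤ κ) (he : e ^ 2 ≤ κ * χ) :
    -(χ * a * a + g * e * a) ≤ κ / 4 * g ^ 2 := by
  rcases hχ.eq_or_lt with h0 | hpos
  · have he0 : e = 0 := by
      rw [← h0, mul_zero] at he
      nlinarith [sq_nonneg e]
    rw [← h0, he0]
    nlinarith [mul_nonneg hκ (sq_nonneg g)]
  · by_contra hneg
    push Not at hneg
    have h1 : χ * (χ * a * a + g * e * a + κ / 4 * g ^ 2) < 0 := mul_neg_of_pos_of_neg hpos (by linarith)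
    have h2 : 0 ≤ χ * (χ * a * a + g * e * a + κ / 4 * g ^ 2) := by
      nlinarith [sq_nonneg (χ * a + e * g / 2), mul_nonneg (sub_nonneg.2 he) (sq_nonneg g)]
    linarith

section Pinned

variable {ω₂ lam β : ℝ} {L : ℕ}

/-- **The energy estimate at cutoff level `n`.** For the pinned chain (`ω₂ > 0`, `lam, β ≥ 0`),
`T > 0`, site weights `B ≥ 0`, any `σ`, `c ≥ 0`, and `g ∈ C²` with `∫ g² e^{-H/T} < ∞` solving
`λ g = σ X_H g + c S_B g` pointwise:
`λ ∫ χ_n g² e^{-H/T} ≤ (c T K Σ_i B_i / (n+1)) ∫ g² e^{-H/T}` (`χ_n = chi`, `K = kuboConst`).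
[folklore] -/
theorem pinnedChain_resolvent_energy_estimate (hω : 0 < ω₂) (hl : 0 ≤ lam) (hβ : 0 ≤ β) (γ : ℝ)
    (L : ℕ) {T : ℝ} (hT : 0 < T) (B : Fin L → ℝ) (hB : ∀ i, 0 ≤ B i) (σ : ℝ) {c : ℝ} (hc : 0 ≤ c)
    (lam' : ℝ) {g : PhaseSpace L → ℝ} (hg : ContDiff ℝ 2 g)
    (hg2 : Integrable (fun x => g x ^ 2 * (pinnedChain ω₂ lam β γ).gibbsDensity L T x))
    (hpde : ∀ x, lam' * g x =
      σ * liouvilleOp (pinnedChain ω₂ lam β γ) L g x + c * bathOp L B T g x) (n : ℕ) :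
    lam' * ∫ x, chi (pinnedChain ω₂ lam β γ) L n x * g x ^ 2 *
        (pinnedChain ω₂ lam β γ).gibbsDensity L T x ≤
      c * T * kuboConst * (∑ i, B i) / ((n : ℝ) + 1) *
        ∫ x, g x ^ 2 * (pinnedChain ω₂ lam β γ).gibbsDensity L T x := by
  obtain ⟨hφs, -, -, hφnn, -, hK, hdsq, -, -, -, hd2⟩ := kuboProfile_spec
  have hφd : Differentiable ℝ kuboProfile := hφs.differentiable (by simp)
  have hU : ContDiff ℝ ∞ (pinnedChain ω₂ lam β γ).U := pinnedChain_contDiff_U ω₂ lam β γ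
  have hV : ContDiff ℝ ∞ (pinnedChain ω₂ lam β γ).V := pinnedChain_contDiff_V ω₂ lam β γ
  have hU1 : ContDiff ℝ 1 (pinnedChain ω₂ lam β γ).U := pinnedChain_contDiff_U ω₂ lam β γ
  have hV1 : ContDiff ℝ 1 (pinnedChain ω₂ lam β γ).V := pinnedChain_contDiff_V ω₂ lam β γ
  have hHs : ContDiff ℝ ∞ ((pinnedChain ω₂ lam β γ).hamiltonian L) :=
    (pinnedChain ω₂ lam β γ).contDiff_hamiltonian hU hV L
  have hρc : Continuous ((pinnedChain ω₂ lam β γ).gibbsDensity L T) :=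
    pinnedChain_continuous_gibbsDensity ω₂ lam β γ L T
  have hρpos : ∀ x, 0 < (pinnedChain ω₂ lam β γ).gibbsDensity L T x := fun x =>
    (pinnedChain ω₂ lam β γ).gibbsDensity_pos L T x
  have hχs : ContDiff ℝ ∞ (chi (pinnedChain ω₂ lam β γ) L n) := contDiff_chi hHs n
  have hχcs : HasCompactSupport (chi (pinnedChain ω₂ lam β γ) L n) :=
    hasCompactSupport_chi hω hl hβ γ L n
  have hχd : Differentiable ℝ (chi (pinnedChain ω₂ lam β γ) L n) := hχs.differentiable (by simp)
  have hχc : Continuous (chi (pinnedChain ω₂ lam β γ) L n) := hχs.continuous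
  have hg1 : ∀ i, ContDiff ℝ 1 (partialP i g) := fun i => contDiff_partialP hg (by norm_num) i
  have hPgc : ∀ i, Continuous (partialP i g) := fun i => (hg1 i).continuous
  have hPχc : ∀ i, Continuous (partialP i (chi (pinnedChain ω₂ lam β γ) L n)) := fun i =>
    continuous_partialP hχs (by simp) i
  have hPχcs : ∀ i, HasCompactSupport (partialP i (chi (pinnedChain ω₂ lam β γ) L n)) := fun i =>
    hasCompactSupport_partialP hχd hχcs i
  have hgc : Continuous g := hg.continuous
  have hXc : Continuous (liouvilleOp (pinnedChain ω₂ lam β γ) L g) :=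
    continuous_liouvilleOp _ hU1 hV1 (hg.of_le (by norm_num))
  have hSc : Continuous (bathOp L B T g) := continuous_bathOp hg B T
  -- integrability at the cutoff level (everything is continuous with compact support)
  have iX : Integrable (fun x => chi (pinnedChain ω₂ lam β γ) L n x * g x *
      liouvilleOp (pinnedChain ω₂ lam β γ) L g x * (pinnedChain ω₂ lam β γ).gibbsDensity L T x) :=
    Continuous.integrable_of_hasCompactSupport (by fun_prop) hχcs.mul_right.mul_right.mul_right
  have iS : Integrable (fun x => chi (pinnedChain ω₂ lam β γ) L n x * g x *
      bathOp L B T g x * (pinnedChain ω₂ lam β γ).gibbsDensity L T x) :=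
    Continuous.integrable_of_hasCompactSupport (by fun_prop) hχcs.mul_right.mul_right.mul_right
  -- (1) test the equation against `χ_n g ρ`
  have h1 : lam' * ∫ x, chi (pinnedChain ω₂ lam β γ) L n x * g x ^ 2 *
      (pinnedChain ω₂ lam β γ).gibbsDensity L T x =
      σ * (∫ x, chi (pinnedChain ω₂ lam β γ) L n x * g x *
        liouvilleOp (pinnedChain ω₂ lam β γ) L g x * (pinnedChain ω₂ lam β γ).gibbsDensity L T x) +
      c * ∫ x, chi (pinnedChain ω₂ lam β γ) L n x * g x *
        bathOp L B T g x * (pinnedChain ω₂ lam β γ).gibbsDensity L T x := by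
    rw [← integral_const_mul, ← integral_const_mul, ← integral_const_mul,
      ← integral_add (iX.const_mul σ) (iS.const_mul c)]
    refine integral_congr_ae (ae_of_all _ fun x => ?_)
    have e := hpde x
    calc lam' * (chi (pinnedChain ω₂ lam β γ) L n x * g x ^ 2 * (pinnedChain ω₂ lam β γ).gibbsDensity L T x)
        = chi (pinnedChain ω₂ lam β γ) L n x * g x * (lam' * g x) *
            (pinnedChain ω₂ lam β γ).gibbsDensity L T x := by ring
      _ = _ := by rw [e]; ring
  -- (2) the Liouville part drops out exactly
  have h2 : ∫ x, chi (pinnedChain ω₂ lam β γ) L n x * g x *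
      liouvilleOp (pinnedChain ω₂ lam β γ) L g x * (pinnedChain ω₂ lam β γ).gibbsDensity L T x = 0 := by
    have h := integral_chi_liouville_antisymm hω hl hβ γ L hT.ne' hg hg n
    have e : ∫ x, chi (pinnedChain ω₂ lam β γ) L n x *
        (g x * liouvilleOp (pinnedChain ω₂ lam β γ) L g x + g x * liouvilleOp (pinnedChain ω₂ lam β γ) L g x) *
          (pinnedChain ω₂ lam β γ).gibbsDensity L T x =
        2 * ∫ x, chi (pinnedChain ω₂ lam β γ) L n x * g x *
          liouvilleOp (pinnedChain ω₂ lam β γ) L g x * (pinnedChain ω₂ lam β γ).gibbsDensity L T x := by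
      rw [← integral_const_mul]
      exact integral_congr_ae (ae_of_all _ fun x => by ring)
    linarith
  -- (3) the bath part: the Ornstein–Uhlenbeck Dirichlet form at cutoff level
  have h3 := integral_chi_mul_bathOp hω hl hβ γ L B hT.ne' hg hg n
  -- (4) completing the square, site by site
  have h4 : ∀ i, -((∫ x, chi (pinnedChain ω₂ lam β γ) L n x * partialP i g x * partialP i g x *
        (pinnedChain ω₂ lam β γ).gibbsDensity L T x) +
      ∫ x, g x * partialP i (chi (pinnedChain ω₂ lam β γ) L n) x * partialP i g x *
        (pinnedChain ω₂ lam β γ).gibbsDensity L T x) ≤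
      kuboConst / ((n : ℝ) + 1) * ∫ x, g x ^ 2 * (pinnedChain ω₂ lam β γ).gibbsDensity L T x := by
    intro i
    have iA : Integrable (fun x => chi (pinnedChain ω₂ lam β γ) L n x * partialP i g x * partialP i g x *
        (pinnedChain ω₂ lam β γ).gibbsDensity L T x) :=
      Continuous.integrable_of_hasCompactSupport (by fun_prop) hχcs.mul_right.mul_right.mul_right
    have iB : Integrable (fun x => g x * partialP i (chi (pinnedChain ω₂ lam β γ) L n) x * partialP i g x *
        (pinnedChain ω₂ lam β γ).gibbsDensity L T x) :=
      Continuous.integrable_of_hasCompactSupport (by fun_prop) (hPχcs i).mul_left.mul_right.mul_right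
    rw [← integral_add iA iB, ← integral_neg, ← integral_const_mul]
    refine integral_mono (iA.add iB).neg (hg2.const_mul _) fun x => ?_
    have hsq : partialP i (chi (pinnedChain ω₂ lam β γ) L n) x ^ 2 ≤
        4 * kuboConst / ((n : ℝ) + 1) * chi (pinnedChain ω₂ lam β γ) L n x :=
      partialP_cutoff_sq_le hω.le hl hβ γ L hφd hK hφnn hdsq hd2 (one_le_radius n) i x
    have hκ : 0 ≤ 4 * kuboConst / ((n : ℝ) + 1) := by positivity
    have key := resolvent_cross_aux (a := partialP i g x) (g := g x) (chi_nonneg n x) hκ hsq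
    have hρ0 : 0 ≤ (pinnedChain ω₂ lam β γ).gibbsDensity L T x := (hρpos x).le
    have := mul_le_mul_of_nonneg_right key hρ0
    calc -(chi (pinnedChain ω₂ lam β γ) L n x * partialP i g x * partialP i g x *
          (pinnedChain ω₂ lam β γ).gibbsDensity L T x +
          g x * partialP i (chi (pinnedChain ω₂ lam β γ) L n) x * partialP i g x *
          (pinnedChain ω₂ lam β γ).gibbsDensity L T x)
        = -(chi (pinnedChain ω₂ lam β γ) L n x * partialP i g x * partialP i g x +
            g x * partialP i (chi (pinnedChain ω₂ lam β γ) L n) x * partialP i g x) *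
            (pinnedChain ω₂ lam β γ).gibbsDensity L T x := by ring
      _ ≤ 4 * kuboConst / ((n : ℝ) + 1) / 4 * g x ^ 2 * (pinnedChain ω₂ lam β γ).gibbsDensity L T x := this
      _ = kuboConst / ((n : ℝ) + 1) * (g x ^ 2 * (pinnedChain ω₂ lam β γ).gibbsDensity L T x) := by ring
  -- assemble
  have hsum : -T * ∑ i, B i * ((∫ x, chi (pinnedChain ω₂ lam β γ) L n x * partialP i g x * partialP i g x *
        (pinnedChain ω₂ lam β γ).gibbsDensity L T x) +
      ∫ x, g x * partialP i (chi (pinnedChain ω₂ lam β γ) L n) x * partialP i g x *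
        (pinnedChain ω₂ lam β γ).gibbsDensity L T x) ≤
      T * ∑ i, B i * (kuboConst / ((n : ℝ) + 1) *
        ∫ x, g x ^ 2 * (pinnedChain ω₂ lam β γ).gibbsDensity L T x) := by
    rw [neg_mul, ← mul_neg, ← Finset.sum_neg_distrib]
    refine mul_le_mul_of_nonneg_left (Finset.sum_le_sum fun i _ => ?_) hT.le
    rw [← mul_neg]
    exact mul_le_mul_of_nonneg_left (h4 i) (hB i)
  calc lam' * ∫ x, chi (pinnedChain ω₂ lam β γ) L n x * g x ^ 2 * (pinnedChain ω₂ lam β γ).gibbsDensity L T x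
      = c * (-T * ∑ i, B i * ((∫ x, chi (pinnedChain ω₂ lam β γ) L n x * partialP i g x * partialP i g x *
          (pinnedChain ω₂ lam β γ).gibbsDensity L T x) +
        ∫ x, g x * partialP i (chi (pinnedChain ω₂ lam β γ) L n) x * partialP i g x *
          (pinnedChain ω₂ lam β γ).gibbsDensity L T x)) := by
        rw [h1, h2, h3]; ring
    _ ≤ c * (T * ∑ i, B i * (kuboConst / ((n : ℝ) + 1) *
          ∫ x, g x ^ 2 * (pinnedChain ω₂ lam β γ).gibbsDensity L T x)) :=
        mul_le_mul_of_nonneg_left hsum hc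
    _ = c * T * kuboConst * (∑ i, B i) / ((n : ℝ) + 1) *
          ∫ x, g x ^ 2 * (pinnedChain ω₂ lam β γ).gibbsDensity L T x := by
        rw [← Finset.sum_mul]; ring

/-- **`L²(e^{-H/T})` classical solutions of `λ g = σ X_H g + c S_B g` with `λ > 0` vanish**
(dissipativity of `σ X_H + c S_B` in `L²(μ_T)`): for the pinned chain (`ω₂ > 0`, `lam, β ≥ 0`),
`T > 0`, `B ≥ 0`, any `σ`, `c ≥ 0`, `λ > 0`, and `g ∈ C²` with `∫ g² e^{-H/T} < ∞` solving the
equation pointwise, `g ≡ 0` (let `n → ∞` in `pinnedChain_resolvent_energy_estimate`: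
`λ ∫ g² e^{-H/T} ≤ 0`). [folklore] -/
theorem pinnedChain_eq_zero_of_classical_adjoint_resolvent (hω : 0 < ω₂) (hl : 0 ≤ lam) (hβ : 0 ≤ β)
    (γ : ℝ) (L : ℕ) {T : ℝ} (hT : 0 < T) (B : Fin L → ℝ) (hB : ∀ i, 0 ≤ B i) (σ : ℝ) {c : ℝ}
    (hc : 0 ≤ c) {lam' : ℝ} (hlam : 0 < lam') {g : PhaseSpace L → ℝ} (hg : ContDiff ℝ 2 g)
    (hg2 : Integrable (fun x => g x ^ 2 * (pinnedChain ω₂ lam β γ).gibbsDensity L T x))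
    (hpde : ∀ x, lam' * g x =
      σ * liouvilleOp (pinnedChain ω₂ lam β γ) L g x + c * bathOp L B T g x) :
    ∀ x, g x = 0 := by
  have hρpos : ∀ x, 0 < (pinnedChain ω₂ lam β γ).gibbsDensity L T x := fun x =>
    (pinnedChain ω₂ lam β γ).gibbsDensity_pos L T x
  set I : ℝ := ∫ x, g x ^ 2 * (pinnedChain ω₂ lam β γ).gibbsDensity L T x with hI
  have hI0 : 0 ≤ I := integral_nonneg fun x => mul_nonneg (sq_nonneg _) (hρpos x).le
  -- `∫ χ_n g² ρ → ∫ g² ρ`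
  have hlim : Tendsto (fun n : ℕ => ∫ x, chi (pinnedChain ω₂ lam β γ) L n x * g x ^ 2 *
      (pinnedChain ω₂ lam β γ).gibbsDensity L T x) atTop (𝓝 I) :=
    tendsto_integral_chi_mul hω.le hl hβ γ L T (hg.continuous.pow 2).aestronglyMeasurable hg2
  -- the right-hand side of the energy estimate tends to `0`
  have hrhs : Tendsto (fun n : ℕ => c * T * kuboConst * (∑ i, B i) / ((n : ℝ) + 1) * I) atTop (𝓝 0) := by
    have h1 : Tendsto (fun n : ℕ => (n : ℝ) + 1) atTop atTop :=
      tendsto_atTop_add_const_right _ _ tendsto_natCast_atTop_atTop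
    have h : Tendsto (fun n : ℕ => c * T * kuboConst * (∑ i, B i) * I / ((n : ℝ) + 1)) atTop (𝓝 0) :=
      tendsto_const_nhds.div_atTop h1
    refine h.congr fun n => by ring
  have hle : lam' * I ≤ 0 :=
    le_of_tendsto_of_tendsto (hlim.const_mul lam') hrhs (Eventually.of_forall fun n =>
      pinnedChain_resolvent_energy_estimate hω hl hβ γ L hT B hB σ hc lam' hg hg2 hpde n)
  have hI : I = 0 := le_antisymm (by nlinarith) hI0
  -- `∫ g² ρ = 0` forces `g = 0`
  have hae : (fun x => g x ^ 2 * (pinnedChain ω₂ lam β γ).gibbsDensity L T x) =ᵐ[volume] 0 := by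
    rw [← integral_eq_zero_iff_of_nonneg (fun x => mul_nonneg (sq_nonneg _) (hρpos x).le) hg2]
    exact hI
  have hg0 : g =ᵐ[volume] fun _ => 0 := by
    filter_upwards [hae] with x hx
    simp only [Pi.zero_apply, mul_eq_zero] at hx
    rcases hx with hx | hx
    · exact pow_eq_zero_iff two_ne_zero |>.1 hx
    · exact absurd hx (hρpos x).ne'
  have := (Continuous.ae_eq_iff_eq volume hg.continuous continuous_const).1 hg0
  exact fun x => congrFun this x

end Pinned

/-! ### The stub -/

/-- **Stub `stub_resolventRangeDense`** (line `bath-bond-deficit-integral`): for the pinned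
anharmonic chain `pinnedChain ω₂ lam β γ` (`ω₂, lam, β, γ > 0`), `N ≥ 1`, `T > 0`, the equilibrium
Langevin generator `L = L_{T,T}` and `λ > 0`, every measurable `k ∈ L²(μ_T)` with
`∫ (λ F - L F) k dμ_T = 0` for all `F ∈ C_c^∞` vanishes `μ_T`-a.e.; equivalently
`(λ - L)(C_c^∞)` is dense in `L²(μ_T)`. (Hypoelliptic regularity; the classical adjoint equation
`λ g = -X_H g + γ S g` for the smooth representative; the energy estimate with energy cutoffs.)
[folklore] -/
theorem stub_resolventRangeDense : ∀ ω₂ lam β γ : ℝ, 0 < ω₂ → 0 < lam → 0 < β → 0 < γ → ∀ T : ℝ, 0 < T → ∀ (N : ℕ), 0 < N → ∀ lam' : ℝ, 0 < lam' → ∀ k : PhaseSpace N → ℝ, Measurable k → MemLp k 2 ((pinnedChain ω₂ lam β γ).gibbsMeasure N T) → (∀ F : PhaseSpace N → ℝ, ContDiff ℝ ((⊤ : ℕ∞) : WithTop ℕ∞) F → HasCompactSupport F → ∫ x, (lam' * F x - (pinnedChain ω₂ lam β γ).generator N T T F x) * k x ∂((pinnedChain ω₂ lam β γ).gibbsMeasure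 N T) = 0) → k =ᵐ[(pinnedChain ω₂ lam β γ).gibbsMeasure N T] 0 := by
  intro ω₂ lam β γ hω hl hβ hγ T hT N hN lam' hlam k hkm hk2 hweak
  have hU1 : ContDiff ℝ 1 (pinnedChain ω₂ lam β γ).U := pinnedChain_contDiff_U ω₂ lam β γ
  have hV1 : ContDiff ℝ 1 (pinnedChain ω₂ lam β γ).V := pinnedChain_contDiff_V ω₂ lam β γ
  have hρc : Continuous ((pinnedChain ω₂ lam β γ).gibbsDensity N T) :=
    pinnedChain_continuous_gibbsDensity ω₂ lam β γ N T
  have hρpos : ∀ x, 0 < (pinnedChain ω₂ lam β γ).gibbsDensity N T x := fun x =>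
    (pinnedChain ω₂ lam β γ).gibbsDensity_pos N T x
  have hρint : Integrable ((pinnedChain ω₂ lam β γ).gibbsDensity N T) :=
    pinnedChain_integrable_gibbsDensity hω hl.le hβ.le γ N hT
  have hZpos : 0 < ∫ x, (pinnedChain ω₂ lam β γ).gibbsDensity N T x := integral_exp_pos hρint
  haveI := pinnedChain_isProbabilityMeasure_gibbsMeasure hω hl.le hβ.le γ N hT
  have hk1 : Integrable k ((pinnedChain ω₂ lam β γ).gibbsMeasure N T) := hk2.integrable one_le_two
  -- (1) hypoelliptic regularity: `k` is a.e. a smooth `g ∈ L²(μ_T)`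
  obtain ⟨g, hg, -, hkg⟩ :=
    Summit.AtomisticToContinuum.FouriersLaw.Theorems.OddSectorIrreversibility.exists_contDiff_ae_eq_of_weak_resolvent
      hω hl.le hβ.le hγ hN hT lam' hkm hk1 hweak
  have hg2c : ContDiff ℝ 2 g := hg.of_le (by norm_cast)
  have hgL2 : MemLp g 2 ((pinnedChain ω₂ lam β γ).gibbsMeasure N T) := hk2.ae_eq hkg
  have hg2i : Integrable (fun x => g x ^ 2 * (pinnedChain ω₂ lam β γ).gibbsDensity N T x) := by
    have h1 : Integrable (fun x => g x ^ 2) ((pinnedChain ω₂ lam β γ).gibbsMeasure N T) :=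
      hgL2.integrable_sq
    rw [OscillatorChain.gibbsMeasure_eq, integrable_tilted_iff hρint] at h1
    refine h1.congr (ae_of_all _ fun x => ?_)
    simp only [smul_eq_mul, OscillatorChain.exp_neg_hamiltonian_div]
    ring
  -- (2) the weak equation for `g`, in Lebesgue form
  have hweakg : ∀ F : PhaseSpace N → ℝ, ContDiff ℝ ∞ F → HasCompactSupport F →
      ∫ x, (lam' * F x - (pinnedChain ω₂ lam β γ).generator N T T F x) * g x *
        (pinnedChain ω₂ lam β γ).gibbsDensity N T x = 0 := by
    intro F hF hFc
    have h0 := hweak F hF hFc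
    have hae : (fun x => (lam' * F x - (pinnedChain ω₂ lam β γ).generator N T T F x) * k x)
        =ᵐ[(pinnedChain ω₂ lam β γ).gibbsMeasure N T]
        fun x => (lam' * F x - (pinnedChain ω₂ lam β γ).generator N T T F x) * g x := by
      filter_upwards [hkg] with x hx
      rw [hx]
    rw [integral_congr_ae hae, OscillatorChain.integral_gibbsMeasure, mul_eq_zero] at h0
    rcases h0 with h0 | h0
    · exact absurd h0 (inv_ne_zero hZpos.ne')
    · exact h0
  -- (3) the classical adjoint equation `λ g = -X_H g + γ S g`
  have hpde : ∀ x, lam' * g x = (-1) * liouvilleOp (pinnedChain ω₂ lam β γ) N g x +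
      γ * bathOp N (OscillatorChain.bathWeight N) T g x := by
    have hAc : Continuous (fun x => -liouvilleOp (pinnedChain ω₂ lam β γ) N g x +
        (pinnedChain ω₂ lam β γ).γ * bathOp N (OscillatorChain.bathWeight N) T g x) :=
      (continuous_liouvilleOp _ hU1 hV1 (hg.of_le (by norm_cast))).neg.add
        (continuous_const.mul (continuous_bathOp hg2c _ _))
    have hRc : Continuous (fun x => (lam' * g x - (-liouvilleOp (pinnedChain ω₂ lam β γ) N g x +
        (pinnedChain ω₂ lam β γ).γ * bathOp N (OscillatorChain.bathWeight N) T g x)) *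
          (pinnedChain ω₂ lam β γ).gibbsDensity N T x) :=
      ((continuous_const.mul hg.continuous).sub hAc).mul hρc
    have hR : ∀ f : PhaseSpace N → ℝ, ContDiff ℝ ∞ f → HasCompactSupport f →
        ∫ x, f x • ((lam' * g x - (-liouvilleOp (pinnedChain ω₂ lam β γ) N g x +
          (pinnedChain ω₂ lam β γ).γ * bathOp N (OscillatorChain.bathWeight N) T g x)) *
            (pinnedChain ω₂ lam β γ).gibbsDensity N T x) = 0 := by
      intro f hf hfc
      have hf2 : ContDiff ℝ 2 f := hf.of_le (by norm_cast)
      have hadj := integral_generator_mul_eq_adjoint (pinnedChain ω₂ lam β γ) hU1 hV1 N hT.ne' hf2 hfc hg2c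
      have hLc : Continuous ((pinnedChain ω₂ lam β γ).generator N T T f) :=
        (pinnedChain ω₂ lam β γ).continuous_generator hU1 hV1 N T T hf2
      have hLcs : HasCompactSupport ((pinnedChain ω₂ lam β γ).generator N T T f) :=
        (pinnedChain ω₂ lam β γ).hasCompactSupport_generator N T T hf2 hfc
      have i1 : Integrable (fun x => (pinnedChain ω₂ lam β γ).generator N T T f x *
          (g x * (pinnedChain ω₂ lam β γ).gibbsDensity N T x)) :=
        (hLc.mul (hg.continuous.mul hρc)).integrable_of_hasCompactSupport hLcs.mul_right
      have i2 : Integrable (fun x => f x * ((-liouvilleOp (pinnedChain ω₂ lam β γ) N g x +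
          (pinnedChain ω₂ lam β γ).γ * bathOp N (OscillatorChain.bathWeight N) T g x) *
            (pinnedChain ω₂ lam β γ).gibbsDensity N T x)) :=
        (hf.continuous.mul (hAc.mul hρc)).integrable_of_hasCompactSupport hfc.mul_right
      have i3 : Integrable (fun x => lam' * f x * g x * (pinnedChain ω₂ lam β γ).gibbsDensity N T x) :=
        (((continuous_const.mul hf.continuous).mul hg.continuous).mul hρc).integrable_of_hasCompactSupport
          hfc.mul_left.mul_right.mul_right
      have e1 : ∫ x, f x • ((lam' * g x - (-liouvilleOp (pinnedChain ω₂ lam β γ) N g x +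
          (pinnedChain ω₂ lam β γ).γ * bathOp N (OscillatorChain.bathWeight N) T g x)) *
            (pinnedChain ω₂ lam β γ).gibbsDensity N T x) =
          (∫ x, lam' * f x * g x * (pinnedChain ω₂ lam β γ).gibbsDensity N T x) -
          ∫ x, f x * ((-liouvilleOp (pinnedChain ω₂ lam β γ) N g x +
            (pinnedChain ω₂ lam β γ).γ * bathOp N (OscillatorChain.bathWeight N) T g x) *
              (pinnedChain ω₂ lam β γ).gibbsDensity N T x) := by
        rw [← integral_sub i3 i2]
        refine integral_congr_ae (ae_of_all _ fun x => ?_)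
        simp only [smul_eq_mul]
        ring
      have e2 : ∫ x, (lam' * f x - (pinnedChain ω₂ lam β γ).generator N T T f x) * g x *
          (pinnedChain ω₂ lam β γ).gibbsDensity N T x =
          (∫ x, lam' * f x * g x * (pinnedChain ω₂ lam β γ).gibbsDensity N T x) -
          ∫ x, (pinnedChain ω₂ lam β γ).generator N T T f x *
            (g x * (pinnedChain ω₂ lam β γ).gibbsDensity N T x) := by
        rw [← integral_sub i3 i1]
        refine integral_congr_ae (ae_of_all _ fun x => ?_)
        ring
      rw [e1, ← hadj, ← e2]
      exact hweakg f hf hfc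
    have hR0 := ae_eq_zero_of_integral_contDiff_smul_eq_zero hRc.locallyIntegrable hR
    have hRzero := (Continuous.ae_eq_iff_eq volume hRc continuous_const).mp hR0
    intro x
    have hx := congr_fun hRzero x
    have hγ' : (pinnedChain ω₂ lam β γ).γ = γ := rfl
    rcases mul_eq_zero.mp hx with h | h
    · rw [hγ'] at h
      linarith
    · exact absurd h (hρpos x).ne'
  -- (4) the energy estimate: `g ≡ 0`
  have hB : ∀ i, 0 ≤ OscillatorChain.bathWeight N i := fun i => by
    unfold OscillatorChain.bathWeight
    split_ifs <;> norm_num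
  have hzero : ∀ x, g x = 0 :=
    pinnedChain_eq_zero_of_classical_adjoint_resolvent hω hl.le hβ.le γ N hT
      (OscillatorChain.bathWeight N) hB (-1) hγ.le hlam hg2c hg2i hpde
  -- (5) conclusion
  filter_upwards [hkg] with x hx
  rw [hx, Pi.zero_apply]
  exact hzero x

end Summit.AtomisticToContinuum.FouriersLaw.Theorems.SubdiffusiveBondHeat

end
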